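import Summits.QuantumFields.YangMills.Theorems.BalabanUVNodesN11DiagonalOldBranchMeasurable
import Summits.QuantumFields.YangMills.Theorems.BalabanUVNodesN11RePinnedParamDefs

/-!
# DAG node N11 — THE OLD-BRANCH MEASURABILITY BINDER `hmB` AT THE RE-PINNED PARAMETER `rePinH θ`: the certificate residual `ZhPinOfRecord₁₃` has measurable
# `ζ0_j(Y)` (rows `measChi`, `tstep.measW`), so at `rePinH θ` the binder REDUCES to measurability of the OPERAND alone — discharged along the all-large-field
# diagonal (operand explicit), displayed as `hΦ` after a general history (the witness's term values carry no measurability law)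

HEADER — WORK-UNIT METADATA.  Cell `pub-ymgap`, YM-PLAN Track A (HUMAN RULING D-0062), seat `pub-ymgap-dag-n11-d` (g9; R134 fan-out seat N11 [B14], strategy s2),
route `BalabanUVNodes` rev 25, item K1⁷ `StabilityBAtRecordR13SepCoPH` = stmt-QuantumFields-20542 (helper, `--kind proof --supports 20542 --as helper`, count-neutral).
[III] = [Balaban1988Convergent].  Over this seat's `…N11TkOpMeasurable`, `…N11DiagonalOldBranchMeasurable`, `…N11HistoryPinnedResidualDefs` ∕ `…N11RePinnedParamDefs`
(`ZhPinOfRecord₁₃`, `rePinH` and their faces) and p547524's displayed binder `hmB`.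

WHY THIS FILE.  `…N11DiagonalOldBranchMeasurable` discharges `hmB` on the diagonal at the door of K0a's cured witness.  The re-pinned parameter `rePinH θ`
(this seat's A2) serves EVERY no-expansion history; its residual is the certificate family `ZhPinOfRecord₁₃`, whose `ζ0_j(Y)` is the history's pin value
`χ_j(init s)·w_j(s)` on the no-expansion histories and K0a's elsewhere — measurable from the rows `measChi` (p547524 `measurable_chiSeqOfRecord_init`) and `tstep.measW`.
Hence at `rePinH θ` the 𝐓-weights serving any history are measurable, and `hmB` for the step `init s′ → s′` REDUCES to the measurability `hΦ` of the operand
`ω ↦ e^{A_k(init s′)}(U_k(𝐖(ω)))` alone (§3) — a THEOREM along the diagonal (§4: operand explicit), a displayed row after a general history (the witness's term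
values `𝐄, 𝐑, 𝐁` at the background carry no measurability law in `Sect2.TermValues`; located).

WHAT THIS FILE PROVES (0 `sorry`, 0 `def`, standard axioms; `N`-generic).  §1 `measurable_histPinOfRecord₁₃`, ★ `measurable_ζ0_ZhPinOfRecord₁₃`, `measurable_quad_ZhPinOfRecord₁₃` ·
§2 `measurable_zhAt_ζ0_rePinH_of_provisos`, `measurable_zhAt_quad_rePinH`, `measurable_WtOfRecord₁₃H_rePinH_ζ∕_w` (from `θ.Provisos₁₃CoPH`) · §3 ★★ `hmB_rePinH_of_measurable_operand`
(at `rePinH θ`, ANY no-expansion history: `hmB` ⟸ `hΦ`) · §4 ★★ `hmB_rePinH_of_allLarge` (diagonal: discharged from `θ.Provisos₁₃CoPH` + `1 ≤ M`).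

HONEST FRAMING.  Count-neutral kernel bookkeeping; nothing of Bałaban's asserted; `hCB` untouched (located: re-type to joint integrability); the operand
measurability `hΦ` after a general history is a displayed row, inhabited on the diagonal only; N11 NOT discharged; K1⁷ NOT closed; counts unmoved (typed 28∕28 ·
discharged 5∕27).  One finite four-torus programme at fixed `ε = L^{−K}` — NOT ℝ⁴, NOT OS, NOT a mass gap, NOT Clay.
Sources: [III] (2.17)–(2.18) p.257, (2.20)–(2.23) p.258, (3.2)–(3.9) pp.265–266, (3.16)–(3.20) pp.268–269, (3.23)–(3.25) p.270, p.267, (1.11) p.248.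
-/

noncomputable section

open MeasureTheory
open scoped BigOperators Matrix.Norms.L2Operator

namespace Summit.QuantumFields.YangMills.Theorems.BalabanUVNodesN11RePinnedOldBranchMeasurable

open Literature.MathematicalPhysics.QuantumFieldTheory.Balaban1983to89 T4Continuum Node00 Node00.Tk DagBinding
open B15DeterminingSets
open BalabanUVNodesN11TkOpMeasurable BalabanUVNodesN11DiagonalOldBranchMeasurable
open BalabanUVNodesN11HistoryPinnedResidualDefs BalabanUVNodesN11RePinnedParamDefs
open BalabanUVNodesN11NoExpansionAllLargeCoP (init_allLarge)
open BalabanUVNodesN11NoExpansionGeneralStepCoPHOldBranch (measurable_chiSeqOfRecord_init)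

variable {F : T4Family} {N : ℕ} [NeZero N]

/-! ## §1  The certificate residual has measurable `ζ0_j(Y)` -/

section Residual

variable {θ : Stage13Params F N} {p : B12.RunParams}

/-- **THE PIN VALUE OF A HISTORY IS MEASURABLE** given measurability of the old front factor `χ_j(init s)` and joint measurability of def-T's step weight `w_j(s)`
(it reads `((ω j).1, avg_j (ω j).1)`). [cite: Balaban1988Convergent, (2.17)–(2.18) p.257, (3.2)–(3.5) pp.264–265 (bookkeeping)] -/
theorem measurable_histPinOfRecord₁₃ (j : ℕ) (s : SeqOfRecord F θ.ν θ.τ9.M (gOfRecord₁₃ F N θ p) p.K (j + 1))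
    (hχ : Measurable (chiSeqOfRecord F N θ.ν θ.τ9.M (gOfRecord₁₃ F N θ p) p.K j s.init))
    (hmw : Measurable fun z : GaugeField (F.P p.K) (j + 1) (SU N) × GaugeField (F.P p.K) j (SU N) =>
      wOfRecord₉ F N θ.toStage9Params p (gOfRecord₁₃ F N θ p) j s z.2 z.1) :
    Measurable (histPinOfRecord₁₃ θ p j s) := by
  have hV : Measurable fun ω : MultiCfg (F.P p.K) (SU N) (FluctV N) => (ω j).1 := measurable_fst.comp (measurable_pi_apply j)
  have hg : Measurable fun ω : MultiCfg (F.P p.K) (SU N) (FluctV N) => ((avOfRecord F N p.K j).avg (ω j).1, (ω j).1) :=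
    ((avOfRecord_measurable F N p.K j).comp hV).prodMk hV
  have h1 := hχ.comp hV
  have h2 := hmw.comp hg
  exact h1.mul h2

open Classical in
/-- **★ THE CERTIFICATE FAMILY HAS MEASURABLE `ζ0_j(Y)`** for every `(j, Y)` and every raw set pair, given — below `K` — measurability of the old front factors and joint
measurability of def-T's step weights along every history (the no-expansion branch reads the history's pin value; everything else is K0a's residual, §1 of
`…N11DiagonalOldBranchMeasurable`). [cite: Balaban1988Convergent, p.267, (3.16)–(3.20) pp.268–269 (bookkeeping)] -/
theorem measurable_ζ0_ZhPinOfRecord₁₃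
    (hχ : ∀ j, j < p.K → ∀ s : SeqOfRecord F θ.ν θ.τ9.M (gOfRecord₁₃ F N θ p) p.K (j + 1),
      Measurable (chiSeqOfRecord F N θ.ν θ.τ9.M (gOfRecord₁₃ F N θ p) p.K j s.init))
    (hmw : ∀ j, j < p.K → ∀ s : SeqOfRecord F θ.ν θ.τ9.M (gOfRecord₁₃ F N θ p) p.K (j + 1),
      Measurable fun z : GaugeField (F.P p.K) (j + 1) (SU N) × GaugeField (F.P p.K) j (SU N) =>
        wOfRecord₉ F N θ.toStage9Params p (gOfRecord₁₃ F N θ p) j s z.2 z.1)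
    (Ω Λ : ℕ → Set (Site (F.P p.K) 0)) (j : ℕ) (Y : Set (Site (F.P p.K) 0)) : Measurable ((ZhPinOfRecord₁₃ θ p Ω Λ).ζ0 j Y) := by
  by_cases h : j < p.K ∧ ∃ s : SeqOfRecord F θ.ν θ.τ9.M (gOfRecord₁₃ F N θ p) p.K (j + 1), IsNoExpHistAt (θ := θ) (p := p) Ω Λ j s
  · obtain ⟨hj, s, hs⟩ := h
    have hpin := measurable_histPinOfRecord₁₃ j s (hχ j hj s) (hmw j hj s)
    by_cases hT : Y = Set.univ
    · subst hT
      rw [show (ZhPinOfRecord₁₃ θ p Ω Λ).ζ0 j Set.univ = histPinOfRecord₁₃ θ p j s from funext fun ω => ZhPinOfRecord₁₃_ζ0_univ_of_hist hj hs ω]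
      exact hpin
    · by_cases h0 : Y = ∅
      · subst h0
        rw [show (ZhPinOfRecord₁₃ θ p Ω Λ).ζ0 j ∅ = fun ω => 1 - histPinOfRecord₁₃ θ p j s ω from funext fun ω => ZhPinOfRecord₁₃_ζ0_empty_of_hist hj hs ω]
        exact measurable_const.sub hpin
      · rw [show (ZhPinOfRecord₁₃ θ p Ω Λ).ζ0 j Y = fun _ => 0 from funext fun ω => ZhPinOfRecord₁₃_ζ0_of_hist_of_ne_of_ne hj hs hT h0 ω]
        exact measurable_const
  · rw [show (ZhPinOfRecord₁₃ θ p Ω Λ).ζ0 j Y = (ZrOfRecord₁₃ F N θ p).ζ0 j Y from funext fun ω => ZhPinOfRecord₁₃_ζ0_of_not h Y ω]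
    exact measurable_ζ0_ZrOfRecord₁₃ (fun j hj => hmw j hj _) j Y

/-- `quad ≡ 0` of the certificate family is measurable. [cite: Balaban1988Convergent, (3.23) p.270 (bookkeeping)] -/
theorem measurable_quad_ZhPinOfRecord₁₃ (Ω Λ : ℕ → Set (Site (F.P p.K) 0)) (j : ℕ) (Λ' : Set (Site (F.P p.K) 0)) :
    Measurable ((ZhPinOfRecord₁₃ θ p Ω Λ).quad j Λ') :=
  (measurable_const : Measurable fun _ : MultiCfg (F.P p.K) (SU N) (FluctV N) => (0 : ℝ))

end Residual

/-! ## §2  At the re-pinned parameter the residual and the 𝐓-weights serving any history are measurable (from `Provisos₁₃CoPH θ`) -/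

section RePinned

variable (θ : Stage13HParams F N) (p : B12.RunParams)

/-- **THE RESIDUAL SERVING ANY HISTORY AT `rePinH θ` HAS MEASURABLE `ζ0_j(Y)`**, from def-T's core provisos at `θ` (rows `measChi`, `tstep.measW`).
[cite: Balaban1988Convergent, (2.18) p.257, (3.2)–(3.9) pp.265–266, p.267 (bookkeeping)] -/
theorem measurable_zhAt_ζ0_rePinH_of_provisos (h : θ.Provisos₁₃CoPH F N) {n : ℕ}
    (s : SeqOfRecord F θ.ν θ.τ9.M (gOfRecord₁₃ F N θ.toStage13Params p) p.K n) (j : ℕ) (Y : Set (Site (F.P p.K) 0)) :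
    Measurable (((rePinH θ).zhAt p s).ζ0 j Y) := by
  rw [zhAt_rePinH]
  exact measurable_ζ0_ZhPinOfRecord₁₃ (θ := θ.toStage13Params) (p := p) (fun j hj s' => measurable_chiSeqOfRecord_init θ p h hj s')
    (fun j hj s' => (h.tstep p j hj).measW s') s.Ω s.Λ j Y

/-- … and measurable `quad_j(Λ′)` (`≡ 0`). [cite: Balaban1988Convergent, (3.23) p.270 (bookkeeping)] -/
theorem measurable_zhAt_quad_rePinH {n : ℕ} (s : SeqOfRecord F θ.ν θ.τ9.M (gOfRecord₁₃ F N θ.toStage13Params p) p.K n) (j : ℕ) (Λ' : Set (Site (F.P p.K) 0)) :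
    Measurable (((rePinH θ).zhAt p s).quad j Λ') :=
  (measurable_const : Measurable fun _ : MultiCfg (F.P p.K) (SU N) (FluctV N) => (0 : ℝ))

/-- **THE 𝐓-WEIGHTS SERVING ANY HISTORY AT `rePinH θ` HAVE MEASURABLE `ζ_j(Y)`.** [cite: Balaban1988Convergent, (2.21) p.258, (3.16) p.268 (bookkeeping)] -/
theorem measurable_WtOfRecord₁₃H_rePinH_ζ (h : θ.Provisos₁₃CoPH F N) {n : ℕ} (s : SeqOfRecord F θ.ν θ.τ9.M (gOfRecord₁₃ F N θ.toStage13Params p) p.K n)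
    (j : ℕ) (Y : Set (Site (F.P p.K) 0)) : Measurable ((WtOfRecord₁₃H F N (rePinH θ) p s).ζ j Y) :=
  measurable_WtOfRecord₁₃H_ζ (rePinH θ) p s j Y (measurable_zhAt_ζ0_rePinH_of_provisos θ p h s j Y)

/-- **… AND MEASURABLE A-WEIGHTS `w_j(Λ′, Y, S)`.** [cite: Balaban1988Convergent, (2.21) p.258, (3.21) p.269, (3.23) p.270 (bookkeeping)] -/
theorem measurable_WtOfRecord₁₃H_rePinH_w {n : ℕ} (s : SeqOfRecord F θ.ν θ.τ9.M (gOfRecord₁₃ F N θ.toStage13Params p) p.K n)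
    (j : ℕ) (Λ' Y S : Set (Site (F.P p.K) 0)) : Measurable ((WtOfRecord₁₃H F N (rePinH θ) p s).w j Λ' Y S) :=
  measurable_WtOfRecord₁₃H_w (rePinH θ) p s j Λ' Y S (measurable_zhAt_quad_rePinH θ p s j Λ')

/-! ## §3  ★★ At `rePinH θ`, `hmB` for ANY no-expansion step reduces to measurability of the OPERAND alone -/

/-- **★★ `hmB` AT THE RE-PINNED PARAMETER ⟸ MEASURABILITY OF THE OPERAND ALONE**, for EVERY history `s′` (of any length `k+1`) and EVERY operand `Φ` (in particular
the §2 operand `e^{A_k(init s′)}` at any residual, witness, background): the weights serving `s′` are measurable from `θ.Provisos₁₃CoPH` (§2), 11a's branch operator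
preserves measurability (`measurable_tkBranchOfRecord_baseCfg`). [cite: Balaban1988Convergent, (2.18) p.257, (2.20)–(2.21) p.258, (3.24) p.270 (bookkeeping)] -/
theorem hmB_rePinH_of_measurable_operand (h : θ.Provisos₁₃CoPH F N) {k : ℕ}
    (s : SeqOfRecord F θ.ν θ.τ9.M (gOfRecord₁₃ F N θ.toStage13Params p) p.K (k + 1))
    {Φ : SFluct (F.P p.K) (FluctV N) → MSField (F.P p.K) (SU N) → ℝ} (S : ℕ → Set (Site (F.P p.K) 0))
    (hΦ : Measurable fun ω : MultiCfg (F.P p.K) (SU N) (FluctV N) => Φ (S, fun j => (ω j).2) (fun j => (ω j).1)) :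
    Measurable fun U₀ : GaugeField (F.P p.K) k (SU N) =>
      tkBranchOfRecord F N (FluctV N) θ.ν θ.τ9.M _ p.K (WtOfRecord₁₃H F N (rePinH θ) p s) s.init S k
        (fun ω => Φ (S, fun j => (ω j).2) (fun j => (ω j).1)) (baseCfg (V := FluctV N) k U₀) :=
  measurable_tkBranchOfRecord_baseCfg F N (FluctV N) θ.ν θ.τ9.M _ p.K (WtOfRecord₁₃H F N (rePinH θ) p s)
    (fun j Y => measurable_WtOfRecord₁₃H_rePinH_ζ θ p h s j Y) (fun j Λ' Y S' => measurable_WtOfRecord₁₃H_rePinH_w θ p s j Λ' Y S') s.init S k hΦ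

/-! ## §4  ★★ … and along the all-large-field diagonal it is discharged outright -/

/-- **★★ `hmB` AT THE RE-PINNED PARAMETER ALONG THE ALL-LARGE-FIELD DIAGONAL — DISCHARGED** from `θ.Provisos₁₃CoPH` and `1 ≤ M` (operand explicit, §3 of
`…N11DiagonalOldBranchMeasurable`), for every residual, witness, constant and old branch. [cite: Balaban1988Convergent, (2.18) p.257, (2.20)–(2.23) p.258, (3.24) p.270 (bookkeeping)] -/
theorem hmB_rePinH_of_allLarge (h : θ.Provisos₁₃CoPH F N) (hM : 1 ≤ θ.τ9.M) {k : ℕ}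
    (s : SeqOfRecord F θ.ν θ.τ9.M (gOfRecord₁₃ F N θ.toStage13Params p) p.K (k + 1)) (hall : ∀ j, 1 ≤ j → j ≤ k + 1 → s.Ω j = ∅)
    (Rz : Sect2.Residual (F.P p.K) (MatA N)) (t : Sect2.TermValues (F.P p.K) (MatA N) (FluctV N) θ.τ9.M) (E₀ : ℝ) :
    ∀ S ∈ admSOfRecord F θ.ν θ.τ9.M (gOfRecord₁₃ F N θ.toStage13Params p) p.K k s.init,
      Measurable fun U₀ : GaugeField (F.P p.K) k (SU N) =>
        tkBranchOfRecord F N (FluctV N) θ.ν θ.τ9.M _ p.K (WtOfRecord₁₃H F N (rePinH θ) p s) s.init S k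
          (fun ω => sect2Operand F N (FluctV N) p.K (settingOfRecord₁₃ F N θ.toStage13Params p) Rz s.init t E₀
            (UbgOfRecord₁₃CoP F N θ.toStage13Params p k s.init) (S, fun j => (ω j).2) (fun j => (ω j).1))
          (baseCfg (V := FluctV N) k U₀) := fun S _ =>
  hmB_rePinH_of_measurable_operand θ p h s S
    (measurable_sect2Operand_CoP_of_allLarge θ.toStage13Params p hM s.init (init_allLarge θ.toStage13Params p s hall) Rz t E₀ S)

end RePinned

end Summit.QuantumFields.YangMills.Theorems.BalabanUVNodesN11RePinnedOldBranchMeasurable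

end
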